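import Summits.AtomisticToContinuum.HydrodynamicLimit.Theses.EnskogAdjointDuality
import Summits.AtomisticToContinuum.HydrodynamicLimit.Theorems.EnskogAdjointDualityDualityReductionAssembly
import Summits.AtomisticToContinuum.HydrodynamicLimit.Theorems.EnskogAdjointDualityDualityReductionInitial
import Summits.AtomisticToContinuum.HydrodynamicLimit.Theorems.EnskogAdjointDualityDualityReductionLBound
import Summits.AtomisticToContinuum.HydrodynamicLimit.Theorems.EnskogAdjointDualityDualityReductionLMeasurable
import Summits.AtomisticToContinuum.HydrodynamicLimit.Theorems.EnskogAdjointDualityDualityReductionFSide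
import Summits.AtomisticToContinuum.HydrodynamicLimit.Theorems.EnskogAdjointDualityDualityReductionProfiles
import HarnessLib

/-!
# EnskogAdjointDuality / DualityReduction — the duality argument for smooth test functions

Support theorem for `Summit.AtomisticToContinuum.HydrodynamicLimit.Theses.EnskogAdjointDuality.DualityReduction`
(stmt-AtomisticToContinuum-11590): on the EOS window `(0, η₁)` the two cruxes of the route —
`CollisionResidualVanishes` (K1) and `AdjointEnskogTestFamilyR` (K2R) — give, for every SMOOTH
`χ` and constants `a, e ∈ ℝ`, `b ∈ ℝ³`, the mean-square convergence of the tested hydrodynamic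
quantity `⟨μ^N_t, χ(a + b·v + e|v|²/2)⟩` to `∫∫ f_t χ(a + b·v + e|v|²/2)` at every `t ∈ (0, T)` along
every packing-guarded classical hs-Euler solution matched to the local Gibbs data at `t = 0`.
This is the instantiation of the abstract assembly (helper 10) with the backward family of K2R,
the residual of K1, the Euler-side bound (helper 8), the initial term (helper 11), the growth and
measurability of the test-side operator (helpers 6–7) and the window profiles (helper 12).

* `smooth_core` — the statement above, with `σ₀ = min(σ₀(K1), σ₀(K2R), 1/2)`.

References: M. Pulvirenti, S. Simonella, arXiv:1504.03215 [PulvirentiSimonella2016];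
T. Bodineau, I. Gallagher, L. Saint-Raymond, Ann. PDE 3 (2017) [BGSR2017]; H. Spohn (1991) [Spohn1991].
-/

noncomputable section

open MeasureTheory Set Filter Topology Function
open scoped ENNReal BigOperators InnerProductSpace

namespace Summit.AtomisticToContinuum.HydrodynamicLimit.Theorems

open Literature.Analysis.FluidPDE Literature.MathematicalPhysics.KineticTheory
  Literature.Analysis.FunctionSpaces
open Literature.MathematicalPhysics.QuantumLattice (clamp_mem_Icc clamp_eq_self)
open Summit.AtomisticToContinuum.HydrodynamicLimit.Theses.EnskogAdjointDuality

variable {a₀ θ₀ : T3 → ℝ} {u₀ : T3 → V3}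

/-- **The duality argument for smooth test functions.** On an EOS window `(0, η₁)` (`f_ex`
analytic, `f_ex' > 0`, `(ηZ)' > 0`), the cruxes `CollisionResidualVanishes` and
`AdjointEnskogTestFamilyR` imply: for continuous positive profiles there is `σ₀ > 0` such that for
`0 < σ < σ₀`, every classical hs-Euler solution on `[0, T)` whose local Gibbs data satisfy the
`t = 0` law of large numbers and whose packing stays below `η₁` on `[0, T)`, every `t ∈ (0, T)`,
every smooth `χ` and all `a, e ∈ ℝ`, `b ∈ ℝ³`:
`∫ (⟨μ^N_{Φ_t z}, χ(a+b·v+e|v|²/2)⟩ − ∫∫ f_t χ(a+b·v+e|v|²/2))² dP_N(z) → 0`.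
[cite: PulvirentiSimonella2016, §2] -/
theorem smooth_core {η₁ : ℝ} (hη₁ : 0 < η₁)
    (hA : AnalyticOnNhd ℝ hsExcessFreeEnergy (Set.Ioo 0 η₁))
    (hB : ∀ η ∈ Set.Ioo 0 η₁, 0 < deriv hsExcessFreeEnergy η)
    (hC : ∀ η ∈ Set.Ioo 0 η₁, 0 < deriv (fun x : ℝ => x * hsCompressibility x) η)
    (h1 : CollisionResidualVanishes) (h2 : AdjointEnskogTestFamilyR)
    (ha : Continuous a₀) (hθ : Continuous θ₀) (hu : Continuous u₀)
    (ha0 : ∀ x, 0 < a₀ x) (hθ0 : ∀ x, 0 < θ₀ x) :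
    ∃ σ₀ : ℝ, 0 < σ₀ ∧ ∀ σ : ℝ, 0 < σ → σ < σ₀ →
      ∀ (T : ℝ) (ρ θ : ℝ → T3 → ℝ) (u : ℝ → T3 → V3), IsHardSphereEulerSolution σ T ρ u θ →
      ∀ Φ : (N : ℕ) → HardSphereFlow (Torus.geometry (Fin 3)) (hsDiameter σ N) (N + 1),
      TendstoHydroFieldsAt (fun N => localGibbsLaw σ a₀ u₀ θ₀ N (Φ N)) Φ ρ u θ 0 →
      (∀ s ∈ Set.Ico 0 T, ∀ x, ρ s x * σ ^ 3 < η₁) →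
      ∀ t ∈ Set.Ioo 0 T, ∀ χ : T3 → ℝ, Torus.IsSmooth χ → ∀ (a e : ℝ) (b : V3),
      Tendsto (fun N : ℕ => ∫⁻ z, ENNReal.ofReal
        ((((N : ℝ) + 1)⁻¹ * (∑ i, χ ((Φ N).flow t z i).1 *
            (a + ⟪b, ((Φ N).flow t z i).2⟫_ℝ + e * ‖((Φ N).flow t z i).2‖ ^ 2 / 2)) -
          ∫ x, ∫ v, ρ t x * localMaxwellian 1 (θ t x) (u t x) v *
            (χ x * (a + ⟪b, v⟫_ℝ + e * ‖v‖ ^ 2 / 2))) ^ 2)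
        ∂localGibbsLaw σ a₀ u₀ θ₀ N (Φ N)) atTop (𝓝 0) := by
  obtain ⟨σ₁, hσ₁, h1'⟩ := h1 η₁ hη₁ hA hB hC a₀ θ₀ u₀ ha hθ hu ha0 hθ0
  obtain ⟨σ₂, hσ₂, h2'⟩ := h2 η₁ hη₁ hA hB hC
  refine ⟨min (min σ₁ σ₂) (1 / 2), by positivity, ?_⟩
  intro σ hσ hσlt T ρ θ u hEul Φ hLLN hguard t ht χ hχs a e b
  have hσ₁' : σ < σ₁ := hσlt.trans_le ((min_le_left _ _).trans (min_le_left _ _))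
  have hσ₂' : σ < σ₂ := hσlt.trans_le ((min_le_left _ _).trans (min_le_right _ _))
  have hσhalf : σ ≤ 1 / 2 := (hσlt.trans_le (min_le_right _ _)).le
  have htIco : t ∈ Ico 0 T := ⟨ht.1.le, ht.2⟩
  have hguard' : ∀ s ∈ Icc 0 t, ∀ x, ρ s x * σ ^ 3 < η₁ := fun s hs x =>
    hguard s ⟨hs.1, hs.2.trans_lt ht.2⟩ x
  -- the backward family of K2R
  obtain ⟨c, κ, hc, hκ, ⟨C, hadm⟩, hrest⟩ := h2' σ hσ hσ₂' T ρ θ u hEul t ht hguard' χ hχs a e b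
  extract_lets G₀ ε₀ lam f Y φ L at hrest
  obtain ⟨hterm, ⟨η, hη, hev⟩, ⟨c₀, hc₀, hconv⟩, hResT⟩ := hrest
  -- the collision residual of K1 at this family
  have h1'' := h1' σ hσ hσ₁' T ρ θ u hEul Φ hLLN t htIco hguard' c κ hc hκ ⟨C, hadm⟩
  -- profiles on the window
  obtain ⟨hρc, huc, hθc, R, U, Θ, hρb, hub, hθb⟩ := eulerProfiles_window hEul ht.2
  have hρb' : ∀ s ∈ Icc 0 t, ∀ x, 0 ≤ ρ s x ∧ ρ s x ≤ R := fun s hs x =>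
    ⟨(hρb s hs x).1.le, (hρb s hs x).2⟩
  obtain ⟨hYc, Ybar, hYb⟩ := contactValue_window (t := t) hσ hA hρc (fun s hs x => (hρb s hs x).1) hguard'
  obtain ⟨CG, hCG0, hCG⟩ := exists_integral_one_add_norm_sq_sq_gaussMeasure_le U Θ
  -- continuity and growth of the test functions
  have hφc : ∀ N, Continuous fun p : ℝ × T3 × V3 => φ N p.1 p.2.1 p.2.2 := by
    intro N
    have hcN : Continuous fun p : ℝ × T3 × V3 => c N p.1 p.2.1 :=
      (hc N).comp (continuous_fst.prodMk continuous_snd.fst)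
    have h1c : Continuous fun p : ℝ × T3 × V3 => (c N p.1 p.2.1).1 := continuous_fst.comp hcN
    have h21 : Continuous fun p : ℝ × T3 × V3 => (c N p.1 p.2.1).2.1 :=
      continuous_fst.comp (continuous_snd.comp hcN)
    have h22 : Continuous fun p : ℝ × T3 × V3 => (c N p.1 p.2.1).2.2 :=
      continuous_snd.comp (continuous_snd.comp hcN)
    show Continuous fun p : ℝ × T3 × V3 => (c N p.1 p.2.1).1 + ⟪(c N p.1 p.2.1).2.1, p.2.2⟫_ℝ +
      (c N p.1 p.2.1).2.2 * ‖p.2.2‖ ^ 2 / 2 + (lam N)⁻¹ * κ N p.1 p.2.1 p.2.2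
    exact ((h1c.add (h21.inner continuous_snd.snd)).add
      ((h22.mul (continuous_snd.snd.norm.pow 2)).div_const 2)).add (continuous_const.mul (hκ N))
  have hφb : ∀ N s x v, |φ N s x v| ≤ (3 * C + |(lam N)⁻¹| * C) * (1 + ‖v‖ ^ 2) := fun N s x v =>
    abs_testFn_le v (hadm N s x x v v).1 (hadm N s x x v v).2.2.1
  -- the test-side operator: growth and measurability, per `N`
  have hπc : Continuous fun s : ℝ => max 0 (min t s) :=
    continuous_const.max (continuous_const.min continuous_id)
  have hLfacts : ∀ N, ∃ K : ℝ, (∀ s ∈ Icc 0 t, ∀ x v, |L N s x v| ≤ K * (1 + ‖v‖ ^ 2) ^ 2) ∧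
      Measurable fun p : ℝ × T3 × V3 => L N (max 0 (min t p.1)) p.2.1 p.2.2 := by
    intro N
    obtain ⟨K, -, hK⟩ := abs_enskogL_le (t := t)
      (Yf := fun s x' => 3 / (2 * Real.pi) * deriv hsExcessFreeEnergy (σ ^ 3 * ρ s x'))
      (g := ρ) (θf := θ) (uf := u) (φ := φ N)
      (xs := fun x ω => G₀.translate x ((ε₀ N / 2) • (ω : V3)))
      (ys := fun x ω => G₀.translate x (ε₀ N • (ω : V3)))
      (Ybar := Ybar) (R := R) (U := U) (Θ := Θ) (Cφ := 3 * C + |(lam N)⁻¹| * C) (lam := lam N)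
      hYb hρb' hub hθb (fun s _ x v => hφb N s x v) (L N) (fun s x v => rfl)
    refine ⟨K, hK, ?_⟩
    have hsm1 : Continuous fun p : T3 × Metric.sphere (0 : V3) 1 => (ε₀ N / 2) • (p.2 : V3) := by
      fun_prop
    have hsm2 : Continuous fun p : T3 × Metric.sphere (0 : V3) 1 => ε₀ N • (p.2 : V3) := by
      fun_prop
    have hxs : Continuous (uncurry fun (x : T3) (ω : Metric.sphere (0 : V3) 1) =>
        G₀.translate x ((ε₀ N / 2) • (ω : V3))) := by
      show Continuous fun p : T3 × Metric.sphere (0 : V3) 1 => p.1 + Torus.proj ((ε₀ N / 2) • (p.2 : V3))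
      exact continuous_fst.add (Torus.continuous_proj.comp hsm1)
    have hys : Continuous (uncurry fun (x : T3) (ω : Metric.sphere (0 : V3) 1) =>
        G₀.translate x (ε₀ N • (ω : V3))) := by
      show Continuous fun p : T3 × Metric.sphere (0 : V3) 1 => p.1 + Torus.proj (ε₀ N • (p.2 : V3))
      exact continuous_fst.add (Torus.continuous_proj.comp hsm2)
    exact measurable_enskogL_of_continuous
      (Yf := fun s x' => 3 / (2 * Real.pi) * deriv hsExcessFreeEnergy (σ ^ 3 * ρ (max 0 (min t s)) x'))
      (g := fun s => ρ (max 0 (min t s))) (θf := fun s => θ (max 0 (min t s)))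
      (uf := fun s => u (max 0 (min t s))) (φ := fun s => φ N (max 0 (min t s)))
      (xs := fun x ω => G₀.translate x ((ε₀ N / 2) • (ω : V3)))
      (ys := fun x ω => G₀.translate x (ε₀ N • (ω : V3))) (lam := lam N)
      (continuous_frozen (g := fun s x' => 3 / (2 * Real.pi) * deriv hsExcessFreeEnergy (σ ^ 3 * ρ s x'))
        ht.1.le hYc) (continuous_frozen ht.1.le hρc) (continuous_frozen ht.1.le hθc)
      (fun s x => (hθb _ (clamp_mem_Icc ht.1.le s) x).1) (continuous_frozen ht.1.le huc)
      ((hφc N).comp ((hπc.comp continuous_fst).prodMk continuous_snd)) hxs hys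
      (fun s => L N (max 0 (min t s))) (fun s x v => rfl)
  -- the frozen Maxwellian weight is measurable
  have hfrozc : Continuous fun p : ℝ × T3 × V3 => f (max 0 (min t p.1)) p.2.1 p.2.2 := by
    have hq : Continuous fun p : ℝ × T3 × V3 => ((p.1, p.2.1) : ℝ × T3) :=
      continuous_fst.prodMk continuous_snd.fst
    have hρf := (continuous_frozen ht.1.le hρc).comp hq
    have hθf := (continuous_frozen ht.1.le hθc).comp hq
    have huf := (continuous_frozen ht.1.le huc).comp hq
    show Continuous fun p : ℝ × T3 × V3 => ρ (max 0 (min t p.1)) p.2.1 *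
      localMaxwellian 1 (θ (max 0 (min t p.1)) p.2.1) (u (max 0 (min t p.1)) p.2.1) p.2.2
    exact hρf.mul (continuous_localMaxwellian_param hθf
      (fun p => (hθb _ (clamp_mem_Icc ht.1.le p.1) p.2.1).1) huf continuous_snd.snd)
  -- the Euler side: `I₃ + ½ I₂ → 0`
  have hFbound : ∀ᶠ N in atTop, |(∫ s in Icc 0 t, ∫ x, ∫ v, f s x v *
        (derivWithin (fun r => φ N r ((Torus.geometry (Fin 3)).translate x ((r - s) • v)) v)
          (Icc 0 t) s + (1 / 2 : ℝ) * L N s x v)) +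
      (1 / 2 : ℝ) * ∫ s in Icc 0 t, ∫ x, ∫ v, f s x v * L N s x v| ≤ η N * (t * (R * CG)) := by
    filter_upwards [hev] with N hN
    obtain ⟨-, hdef⟩ := hN
    obtain ⟨K, hKb, hKm⟩ := hLfacts N
    have hη0 : 0 ≤ η N := by
      have h := (abs_nonneg _).trans (hdef 0 ⟨le_rfl, ht.1.le⟩ 0 0)
      simpa using h
    exact abs_I3_add_half_I2_le ht.1 hρb' hub hθb hCG (f := f) (fun s x v => rfl)
      (Φf := fun p => f (max 0 (min t p.1)) p.2.1 p.2.2) hfrozc.measurable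
      (fun s hs x v => by simp only [clamp_eq_self hs])
      (fun s x v => derivWithin (fun r => φ N r ((Torus.geometry (Fin 3)).translate x ((r - s) • v)) v)
        (Icc 0 t) s) (L N)
      (Dm := fun p => deriv (fun r => φ N r ((Torus.geometry (Fin 3)).translate p.2.1
        ((r - p.1) • p.2.2)) p.2.2) p.1)
      (Lm := fun p => L N (max 0 (min t p.1)) p.2.1 p.2.2) (measurable_charDeriv (hφc N)) hKm
      (fun s hs x v => derivWithin_charDeriv_eq_deriv hs x v)
      (fun s hs x v => by simp only [clamp_eq_self hs]) hKb hη0 hdef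
  have hF : Tendsto (fun N => (∫ s in Icc 0 t, ∫ x, ∫ v, f s x v *
        (derivWithin (fun r => φ N r ((Torus.geometry (Fin 3)).translate x ((r - s) • v)) v)
          (Icc 0 t) s + (1 / 2 : ℝ) * L N s x v)) +
      (1 / 2 : ℝ) * ∫ s in Icc 0 t, ∫ x, ∫ v, f s x v * L N s x v) atTop (𝓝 0) := by
    refine squeeze_zero_norm' (a := fun N => η N * (t * (R * CG))) (hFbound.mono fun N h => ?_) ?_
    · rw [Real.norm_eq_abs]; exact h
    · simpa using hη.mul_const (t * (R * CG))
  -- the initial term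
  have hlamInv : Tendsto (fun N => (lam N)⁻¹) atTop (𝓝 0) := by
    show Tendsto (fun N : ℕ => ((N : ℝ) * hsDiameter σ N ^ 2)⁻¹) atTop (𝓝 0)
    exact tendsto_lamInv_zero hσ
  have h0mem : (0 : ℝ) ∈ Icc 0 t := ⟨le_rfl, ht.1.le⟩
  have hρ0c : Continuous (ρ 0) :=
    hρc.comp_continuous (continuous_const.prodMk continuous_id) fun x => ⟨h0mem, mem_univ x⟩
  have hu0c : Continuous (u 0) :=
    huc.comp_continuous (continuous_const.prodMk continuous_id) fun x => ⟨h0mem, mem_univ x⟩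
  have hθ0c : Continuous (θ 0) :=
    hθc.comp_continuous (continuous_const.prodMk continuous_id) fun x => ⟨h0mem, mem_univ x⟩
  have h0 := initial_term_tendsto ha hθ hu ha0 hθ0 hσhalf Φ hLLN hρ0c hu0c hθ0c
    (fun x => (hθb 0 h0mem x).1) (fun x => (hρb 0 h0mem x).1.le) c κ hc hκ (C := C)
    (fun N s x v => ⟨(hadm N s x x v v).1, (hadm N s x x v v).2.2.1⟩) (fun N => (lam N)⁻¹) hlamInv
    hc₀ hconv φ (fun N s x v => rfl) f (fun s x v => rfl)
  -- the assembly
  have hmain := duality_assembly ha hθ hu ha0 hθ0 hσhalf Φ ht.1 φ L f _ hφc ⟨η, hη, hev⟩ hLfacts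
    (fun N z => rfl) h1'' hResT hF h0
  -- identify the tested quantity through the terminal condition
  refine hmain.congr fun N => lintegral_congr fun z => ?_
  have hAeq : ((N : ℝ) + 1)⁻¹ * (∑ i, φ N t ((Φ N).flow t z i).1 ((Φ N).flow t z i).2) =
      ((N : ℝ) + 1)⁻¹ * (∑ i, χ ((Φ N).flow t z i).1 *
        (a + ⟪b, ((Φ N).flow t z i).2⟫_ℝ + e * ‖((Φ N).flow t z i).2‖ ^ 2 / 2)) := by
    congr 1
    exact Finset.sum_congr rfl fun i _ => hterm N _ _
  have hBeq : (∫ x, ∫ v, f t x v * φ N t x v) = ∫ x, ∫ v, ρ t x * localMaxwellian 1 (θ t x) (u t x) v *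
      (χ x * (a + ⟪b, v⟫_ℝ + e * ‖v‖ ^ 2 / 2)) := by
    refine integral_congr_ae (Eventually.of_forall fun x => integral_congr_ae
      (Eventually.of_forall fun v => ?_))
    show f t x v * φ N t x v = _
    rw [hterm]
  rw [hAeq, hBeq]

end Summit.AtomisticToContinuum.HydrodynamicLimit.Theorems

end
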